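import Summits.AtomisticToContinuum.HydrodynamicLimit.Theorems.RelayRaceLocalityNearConstantShortTimeHLAssemblyTheta
import HarnessLib

/-!
# Crux `NearConstantShortTimeHL` (stmt-AtomisticToContinuum-12502), line `small-tilt-domination` — stubs `cubicTail_le_gauss`, `integral_cubicTail_flow_le`

Support file for the crux `…Theses.RelayRaceLocality.NearConstantShortTimeHL` (route
`route-AtomisticToContinuum-RelayRaceLocality`), line `small-tilt-domination`, stubs `cubicTail_le_gauss` and
`integral_cubicTail_flow_le` of the relative-entropy Grönwall assembly (`stub_gronwallAssembly`, lead c4).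

In the Grönwall assembly (Yau's relative-entropy method for hard spheres) the cubic energy flux on bad balls is
truncated at level `L`; the tail `cubicTail L w = n⁻¹ Σᵢ ‖vᵢ‖³ 𝟙{‖vᵢ‖ > L}` along the TRUE law is priced by the
Gaussian velocity-tail input `E[n⁻¹ Σᵢ exp(a ‖vᵢ(s)‖²)] ≤ A` with the RATE `L³ e^{−aL²}` (which is what lets
`L → ∞` beat the Grönwall factor):

* `cubicTail_le_gauss` (pointwise): for `a > 0` and `L ≥ √(3/(2a))`,
  `cubicTail L w ≤ L³ e^{−aL²} · n⁻¹ Σᵢ exp(a ‖vᵢ‖²)`. The one-particle inequality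
  `r³ ≤ L³ e^{−aL²} e^{a r²}` for `r > L` (`xv_cube_le_gauss`) is the monotonicity of `r ↦ r³ e^{−a r²}` on
  `[√(3/(2a)), ∞)`, proved algebraically: with `x = r/L ≥ 1` and `c = aL² ≥ 3/2`,
  `x³ ≤ e^{3(x−1)} ≤ e^{c(x²−1)}` (`xv_pow_three_le_exp`, from `1 + y ≤ eʸ` and `2(x − 1) ≤ x² − 1`).
* `integral_cubicTail_flow_le` (integrated along a hard-sphere flow `Φ` at time `s` under a finite law `P`):
  if `∫⁻ ofReal (n⁻¹ Σᵢ exp(a ‖vᵢ(s)‖²)) dP ≤ ofReal A` then `z ↦ cubicTail L (Φ_s z)` is `P`-integrable and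
  `∫ cubicTail L (Φ_s z) dP ≤ L³ e^{−aL²} A` (domination by the integrable Gaussian moment; measurability through
  `Φ.measurable_flow s`).

References: H.-T. Yau, Lett. Math. Phys. 22 (1991) §2 (the large-velocity cutoff in the relative-entropy method).
-/

noncomputable section

namespace Summit.AtomisticToContinuum.HydrodynamicLimit.Theorems.NearConstantShortTimeHL

open scoped BigOperators ENNReal Topology
open MeasureTheory Set Filter
open Literature.MathematicalPhysics.KineticTheory Literature.Analysis.FluidPDE Literature.Analysis.FunctionSpaces

/-! ## The one-particle Gaussian domination of the cubic tail -/

/-- `x³ ≤ exp(c (x² − 1))` for `x ≥ 1` and `c ≥ 3/2`: cube `x ≤ e^{x−1}` (i.e. `1 + y ≤ eʸ`) and use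
`3(x − 1) ≤ (3/2)(x² − 1) ≤ c (x² − 1)`. [folklore] -/
theorem xv_pow_three_le_exp {x c : ℝ} (hx : 1 ≤ x) (hc : 3 / 2 ≤ c) :
    x ^ 3 ≤ Real.exp (c * (x ^ 2 - 1)) := by
  have h1 : x ≤ Real.exp (x - 1) := by linarith [Real.add_one_le_exp (x - 1)]
  have h0 : 0 ≤ x := le_trans zero_le_one hx
  calc x ^ 3 ≤ Real.exp (x - 1) ^ 3 := by gcongr
    _ = Real.exp (3 * (x - 1)) := by rw [← Real.exp_nat_mul]; norm_num
    _ ≤ Real.exp (c * (x ^ 2 - 1)) := by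
        refine Real.exp_le_exp.mpr ?_
        have hx2 : 0 ≤ x ^ 2 - 1 := by nlinarith
        nlinarith [mul_nonneg (sub_nonneg.mpr hc) hx2, sq_nonneg (x - 1)]

/-- A level above the threshold is positive: `0 < √(3/(2a)) ≤ L`. [folklore] -/
theorem xv_level_pos {a L : ℝ} (ha : 0 < a) (hL : Real.sqrt (3 / (2 * a)) ≤ L) : 0 < L :=
  lt_of_lt_of_le (Real.sqrt_pos.mpr (by positivity)) hL

/-- Above the threshold, `3/2 ≤ a L²`. [folklore] -/
theorem xv_threshold {a L : ℝ} (ha : 0 < a) (hL : Real.sqrt (3 / (2 * a)) ≤ L) : 3 / 2 ≤ a * L ^ 2 := by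
  have h1 : 3 / (2 * a) ≤ L ^ 2 := by
    calc 3 / (2 * a) = Real.sqrt (3 / (2 * a)) ^ 2 := by rw [Real.sq_sqrt]; positivity
      _ ≤ L ^ 2 := by gcongr
  have ha' : a ≠ 0 := ha.ne'
  calc (3 : ℝ) / 2 = a * (3 / (2 * a)) := by field_simp
    _ ≤ a * L ^ 2 := by gcongr

/-- **One-particle Gaussian domination**: for `a > 0`, `L ≥ √(3/(2a))` and `r > L`,
`r³ ≤ L³ e^{−aL²} e^{a r²}` (monotonicity of `r ↦ r³ e^{−ar²}` past its maximum point `√(3/(2a))`). [folklore] -/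
theorem xv_cube_le_gauss {a L r : ℝ} (ha : 0 < a) (hL : Real.sqrt (3 / (2 * a)) ≤ L) (hr : L < r) :
    r ^ 3 ≤ L ^ 3 * Real.exp (-(a * L ^ 2)) * Real.exp (a * r ^ 2) := by
  have hL0 : 0 < L := xv_level_pos ha hL
  have hx : 1 ≤ r / L := by rw [le_div_iff₀ hL0]; linarith
  have key := xv_pow_three_le_exp hx (xv_threshold ha hL)
  have e1 : (r / L) ^ 3 = r ^ 3 / L ^ 3 := div_pow r L 3
  have hL' : L ≠ 0 := hL0.ne'
  have e2 : a * L ^ 2 * ((r / L) ^ 2 - 1) = a * r ^ 2 + -(a * L ^ 2) := by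
    field_simp
    ring
  rw [e1, e2, div_le_iff₀ (by positivity), Real.exp_add] at key
  exact key.trans (le_of_eq (by ring))

/-- The one-particle cubic tail is dominated by the Gaussian moment:
`‖v‖³ 𝟙{‖v‖ > L} ≤ L³ e^{−aL²} e^{a‖v‖²}` for `a > 0`, `L ≥ √(3/(2a))`. [folklore] -/
theorem xv_indicator_cube_le {a L : ℝ} (ha : 0 < a) (hL : Real.sqrt (3 / (2 * a)) ≤ L) (v : V3) :
    Set.indicator {v : V3 | L < ‖v‖} (fun v => ‖v‖ ^ 3) v ≤
      L ^ 3 * Real.exp (-(a * L ^ 2)) * Real.exp (a * ‖v‖ ^ 2) := by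
  by_cases hv : L < ‖v‖
  · rw [Set.indicator_of_mem (show v ∈ {v : V3 | L < ‖v‖} from hv)]
    exact xv_cube_le_gauss ha hL hv
  · rw [Set.indicator_of_notMem (show v ∉ {v : V3 | L < ‖v‖} from hv)]
    have hL0 : 0 < L := xv_level_pos ha hL
    positivity

/-- The cubic tail per particle is nonnegative. [folklore] -/
theorem xv_cubicTail_nonneg {n : ℕ} (L : ℝ) (w : Config n (Fin 3) T3) : 0 ≤ cubicTail L w :=
  mul_nonneg (inv_nonneg.mpr (Nat.cast_nonneg n)) (Finset.sum_nonneg fun i _ =>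
    Set.indicator_nonneg (fun v _ => by positivity) _)

/-- **Gaussian domination of the cubic tail** (pointwise): for `a > 0` and `L ≥ √(3/(2a))`,
`n⁻¹ Σᵢ ‖vᵢ‖³ 𝟙{‖vᵢ‖ > L} ≤ L³ e^{−aL²} · n⁻¹ Σᵢ exp(a ‖vᵢ‖²)` — sum the one-particle domination
`xv_indicator_cube_le` over the particles. [folklore] -/
theorem cubicTail_le_gauss : ∀ {n : ℕ} {a L : ℝ}, 0 < a → Real.sqrt (3 / (2 * a)) ≤ L → ∀ w : Config n (Fin 3) T3, cubicTail L w ≤ L ^ 3 * Real.exp (-(a * L ^ 2)) * ((n : ℝ)⁻¹ * ∑ i, Real.exp (a * ‖(w i).2‖ ^ 2)) := by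
  intro n a L ha hL w
  calc cubicTail L w
        = (n : ℝ)⁻¹ * ∑ i, Set.indicator {v : V3 | L < ‖v‖} (fun v => ‖v‖ ^ 3) (w i).2 := rfl
    _ ≤ (n : ℝ)⁻¹ * ∑ i, L ^ 3 * Real.exp (-(a * L ^ 2)) * Real.exp (a * ‖(w i).2‖ ^ 2) := by
        gcongr with i _
        exact xv_indicator_cube_le ha hL (w i).2
    _ = L ^ 3 * Real.exp (-(a * L ^ 2)) * ((n : ℝ)⁻¹ * ∑ i, Real.exp (a * ‖(w i).2‖ ^ 2)) := by
        rw [← Finset.mul_sum]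
        ring

/-! ## Integration along the flow against the Gaussian velocity-tail input -/

/-- The velocity of particle `i` at time `s` is a measurable function of the initial datum (`Φ.measurable_flow`).
[folklore] -/
theorem xv_measurable_vel_flow {ε : ℝ} {n : ℕ} (Φ : HardSphereFlow (Torus.geometry (Fin 3)) ε n) (s : ℝ)
    (i : Fin n) : Measurable fun z : Config n (Fin 3) T3 => ((Φ.flow s z) i).2 := by
  have h : Measurable fun w : Config n (Fin 3) T3 => (w i).2 := (measurable_pi_apply i).snd
  exact h.comp (Φ.measurable_flow s)

/-- The Gaussian velocity moment `z ↦ n⁻¹ Σᵢ exp(a ‖vᵢ(s)‖²)` along the flow is measurable. [folklore] -/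
theorem xv_measurable_gaussMoment_flow {ε : ℝ} {n : ℕ} (Φ : HardSphereFlow (Torus.geometry (Fin 3)) ε n)
    (a s : ℝ) :
    Measurable fun z : Config n (Fin 3) T3 =>
      (n : ℝ)⁻¹ * ∑ i : Fin n, Real.exp (a * ‖((Φ.flow s z) i).2‖ ^ 2) := by
  refine Measurable.const_mul (Finset.measurable_sum _ fun i _ => ?_) _
  exact Real.measurable_exp.comp (measurable_const.mul ((xv_measurable_vel_flow Φ s i).norm.pow_const 2))

/-- The cubic tail `z ↦ cubicTail L (Φ_s z)` along the flow is measurable. [folklore] -/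
theorem xv_measurable_cubicTail_flow {ε : ℝ} {n : ℕ} (Φ : HardSphereFlow (Torus.geometry (Fin 3)) ε n)
    (L s : ℝ) : Measurable fun z : Config n (Fin 3) T3 => cubicTail L (Φ.flow s z) := by
  unfold cubicTail
  refine Measurable.const_mul (Finset.measurable_sum _ fun i _ => ?_) _
  exact ((measurable_norm.pow_const 3).indicator (measurableSet_lt measurable_const measurable_norm)).comp
    (xv_measurable_vel_flow Φ s i)

/-- **The cubic tail along the true law is priced by the Gaussian velocity-tail input.** For a hard-sphere flow
`Φ`, a finite law `P` of initial data, `a > 0`, `L ≥ √(3/(2a))`, `A ≥ 0` and a time `s` with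
`∫⁻ ofReal (n⁻¹ Σᵢ exp(a ‖vᵢ(s)‖²)) dP ≤ ofReal A`: the cubic tail `z ↦ cubicTail L (Φ_s z)` is `P`-integrable
and `∫ cubicTail L (Φ_s z) dP ≤ L³ e^{−aL²} A` (pointwise domination `cubicTail_le_gauss` by the integrable Gaussian
moment, `Integrable.mono'`, `integral_mono`). [folklore] -/
theorem integral_cubicTail_flow_le : ∀ {ε : ℝ} {n : ℕ} (Φ : HardSphereFlow (Torus.geometry (Fin 3)) ε n) (P : Measure (Config n (Fin 3) T3)) [IsFiniteMeasure P] {a L A : ℝ}, 0 < a → Real.sqrt (3 / (2 * a)) ≤ L → 0 ≤ A → ∀ (s : ℝ), ∫⁻ z, ENNReal.ofReal ((n : ℝ)⁻¹ * ∑ i : Fin n, Real.exp (a * ‖((Φ.flow s z) i).2‖ ^ 2)) ∂P ≤ ENNReal.ofReal A → Integrable (fun z => cubicTail L (Φ.flow s z)) P ∧ ∫ z, cubicTail L (Φ.flow s z) ∂P ≤ L ^ 3 * Real.exp (-(a * L ^ 2)) * A := by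
  intro ε n Φ P _ a L A ha hL hA0 s hA
  have hL0 : 0 < L := xv_level_pos ha hL
  -- the Gaussian moment `g` is measurable, nonnegative, integrable, with `∫ g ≤ A`
  have hg0 : ∀ z : Config n (Fin 3) T3,
      0 ≤ (n : ℝ)⁻¹ * ∑ i : Fin n, Real.exp (a * ‖((Φ.flow s z) i).2‖ ^ 2) := fun z =>
    mul_nonneg (inv_nonneg.mpr (Nat.cast_nonneg n)) (Finset.sum_nonneg fun i _ => (Real.exp_pos _).le)
  have hgm := xv_measurable_gaussMoment_flow Φ a s
  have hgi : Integrable (fun z : Config n (Fin 3) T3 =>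
      (n : ℝ)⁻¹ * ∑ i : Fin n, Real.exp (a * ‖((Φ.flow s z) i).2‖ ^ 2)) P :=
    (lintegral_ofReal_ne_top_iff_integrable hgm.aestronglyMeasurable (ae_of_all _ hg0)).mp
      (ne_top_of_le_ne_top ENNReal.ofReal_ne_top hA)
  have hgA : ∫ z, (n : ℝ)⁻¹ * ∑ i : Fin n, Real.exp (a * ‖((Φ.flow s z) i).2‖ ^ 2) ∂P ≤ A := by
    rw [integral_eq_lintegral_of_nonneg_ae (ae_of_all _ hg0) hgm.aestronglyMeasurable]
    exact ENNReal.toReal_le_of_le_ofReal hA0 hA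
  -- pointwise domination `0 ≤ cubicTail L (Φ_s z) ≤ L³ e^{−aL²} g z`
  have hdom : ∀ z : Config n (Fin 3) T3, cubicTail L (Φ.flow s z) ≤
      L ^ 3 * Real.exp (-(a * L ^ 2)) * ((n : ℝ)⁻¹ * ∑ i : Fin n, Real.exp (a * ‖((Φ.flow s z) i).2‖ ^ 2)) :=
    fun z => cubicTail_le_gauss ha hL (Φ.flow s z)
  have hfi : Integrable (fun z => cubicTail L (Φ.flow s z)) P := by
    refine Integrable.mono' (hgi.const_mul (L ^ 3 * Real.exp (-(a * L ^ 2))))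
      (xv_measurable_cubicTail_flow Φ L s).aestronglyMeasurable (ae_of_all _ fun z => ?_)
    rw [Real.norm_eq_abs, abs_of_nonneg (xv_cubicTail_nonneg L _)]
    exact hdom z
  refine ⟨hfi, ?_⟩
  calc ∫ z, cubicTail L (Φ.flow s z) ∂P
        ≤ ∫ z, L ^ 3 * Real.exp (-(a * L ^ 2)) *
            ((n : ℝ)⁻¹ * ∑ i : Fin n, Real.exp (a * ‖((Φ.flow s z) i).2‖ ^ 2)) ∂P :=
          integral_mono hfi (hgi.const_mul _) hdom
    _ = L ^ 3 * Real.exp (-(a * L ^ 2)) *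
          ∫ z, (n : ℝ)⁻¹ * ∑ i : Fin n, Real.exp (a * ‖((Φ.flow s z) i).2‖ ^ 2) ∂P := integral_const_mul _ _
    _ ≤ L ^ 3 * Real.exp (-(a * L ^ 2)) * A := mul_le_mul_of_nonneg_left hgA (by positivity)

end Summit.AtomisticToContinuum.HydrodynamicLimit.Theorems.NearConstantShortTimeHL
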